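import Literature.NumberTheory.EllipticCurves.DeligneSerreProp27LevelDescentProofs
import HarnessLib

/-!
# Integrality of the Hecke polynomial of a newform on `Γ₁(N)` — the discharge
# `IsNewform1.exists_map_eq_heckePolynomial_holds`

A proofs-only leaf (one theorem; no definition, no named fact; D-0026) discharging the named fact
`Literature.NumberTheory.EllipticCurves.ModularForms.IsNewform1.exists_map_eq_heckePolynomial`
(`Literature.NumberTheory.EllipticCurves.NewformGaloisRep`): *for a newform `f ∈ S_k(Γ₁(N))`,
`k ≥ 1`, and every `q : ℕ`, the Hecke polynomial `X² − a_q X + ε(q) q^{k−1} ∈ K_f[X]` is the image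
of a polynomial in `𝓞_f[X]`* (`𝓞_f = integralClosure ℤ K_f`) — Shimura 1971, Thm. 3.48 (3) for
`k ≥ 2` (*"the characteristic polynomial of `[X]_k` … has rational integral coefficients"*);
Deligne–Serre 1974, §8.2 with Prop. 2.7 (2.7.3), p. 512 (*"les valeurs propres des `T_p` … sont des
entiers de `K`"*) in every weight `k ≥ 1`; Diamond–Shurman Thm. 6.5.1 in weight `2`.

The tree's proof, assembled here:

* **the fact from (2.7.2) in the same weight** —
  `IsNewform1.exists_map_eq_heckePolynomial_of_span_integralLattice1`
  (`NewformGaloisRepIntegralityProofs`): in a `ℤ`-basis of Deligne–Serre's lattice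
  `L = integralLattice1 N k` (cusp forms all of whose diamond twists are `q`-integral, (2.7.1)) the
  operators `T_p` and `⟨d⟩` have integer matrices, so the eigenvalues `a_p`, the prime-power and
  coprime-product coefficients, and `ε(q) q^{k-1}` are algebraic integers of `K_f`;
* **(2.7.2) at every level `N ≥ 1` and every weight** — `DeligneSerre1974_span_integralLattice1_holds`
  (`DeligneSerreProp27LevelDescentProofs`): for `N ≥ 5` the rank half of Eichler–Shimura for `Γ₁(N)`
  by weight-`k` Manin symbols (`ManinSymbolsWeightKGamma1Rank*`; Shimura 1971, Thm. 8.4), Shimura's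
  Hecke-stable real lattice (3.5.20) and the duality argument of Thm. 3.52
  (`DeligneSerreSpanHeckeDualityProofs`, `DeligneSerreProp27RealLatticeProofs`), the weight descents
  by `E₄`/`E₆` (`DeligneSerreProp27WeightReductionProofs`; Deligne–Serre Rem. 2.8) and by one
  (`DeligneSerreProp27WeightOneDescentProofs`); for `N ≤ 4` by descent of the level from `5N`
  through the degeneracy map `[α₅]_k`.

Everything here is proved; no named facts are introduced.

## References

* G. Shimura, *Introduction to the arithmetic theory of automorphic functions*, Publ. Math. Soc.
  Japan 11, Iwanami Shoten / Princeton UP (1971): Thm. 3.48 (3) (p. 84, "Suppose that `k ≥ 2`"),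
  (3.5.20), Thm. 3.52, Thm. 8.4. [Shimura1971]
* P. Deligne, J.-P. Serre, *Formes modulaires de poids 1*, Ann. Sci. ÉNS (4) 7 (1974), 507–530,
  doi:10.24033/asens.1277: Prop. 2.7 (2.7.2)–(2.7.3) and Rem. 2.8 (p. 512), §8.2 (p. 525).
  [DeligneSerreASENS1974]
* F. Diamond, J. Shurman, *A first course in modular forms*, GTM 228, Springer (2005): Thm. 6.5.1.
  [DiamondShurman2005]
-/

noncomputable section

open scoped MatrixGroups ModularForm

open CongruenceSubgroup

namespace Literature.NumberTheory.EllipticCurves.ModularForms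

variable {N : ℕ} [NeZero N] {k : ℤ} {f : CuspForm (Gamma1 N) k}

/-- **Shimura 1971, Thm. 3.48 (3) / Deligne–Serre 1974, §8.2 with Prop. 2.7** (the named fact
`IsNewform1.exists_map_eq_heckePolynomial`, discharged): for a newform `f ∈ S_k(Γ₁(N))`, `k ≥ 1`,
and every `q : ℕ`, the Hecke polynomial `X² − a_q X + ε(q) q^{k−1} ∈ K_f[X]` is the image of a
polynomial in `𝓞_f[X]` — the Fourier coefficients `a_q(f)` and the values `ε(q) q^{k−1}` are
algebraic integers of `K_f`.  Proof: `IsNewform1.exists_map_eq_heckePolynomial_of_span_integralLattice1`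
(the fact from Deligne–Serre's (2.7.2) in the same weight: integer matrices of `T_p`, `⟨d⟩` in a
`ℤ`-basis of the lattice of cusp forms with `q`-integral diamond twists) fed with (2.7.2) at level
`N` and weight `k`, `DeligneSerre1974_span_integralLattice1_holds N k`.
[cite: Shimura1971, Thm. 3.48 (3)] [cite: DeligneSerreASENS1974, §8.2 with Prop. 2.7 (2.7.3), p. 512] -/
theorem IsNewform1.exists_map_eq_heckePolynomial_holds :
    IsNewform1.exists_map_eq_heckePolynomial (f := f) :=
  IsNewform1.exists_map_eq_heckePolynomial_of_span_integralLattice1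
    (DeligneSerre1974_span_integralLattice1_holds N k)

end Literature.NumberTheory.EllipticCurves.ModularForms
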